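import Literature.Probability.LatticeModels.WeightTable
import HarnessLib

/-!
# The per-pair identities of Smirnov's Lemma 4.5 (cases 1 and 2), and reachability transfer

Topic `Literature/Probability/LatticeModels`; eighth instalment of the discharge programme for
crit-ising.S18, node 1 (s-holomorphicity of the critical FK-Ising observable, corrected form
`isSHolomorphic_fkIsingObservable_of_zdArcA_connected`). Everything here is proved; the two
planar-topology inputs enter as the hypotheses `medialCycle_turning` (T2) and — in the next
instalment — `medialCycle_separates` (T1) of `WeightTable.lean`.

* `arrivalSum φ β c₀ p N`: the sum over the darts `j < N` of the cut orbit arriving at the edge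
  `e = cTgt p` of `eighthPhase (2 C_j) · φ (s_j)`; for `φ s = 1 - κ E(s)` this is "arrivals minus
  `κ`·passages", for `φ s = E(2s) - κ E(s)` "departures minus `κ`·passages" (`passageSum_cTgt`).
* **`arrivalSum_case2`**: if both corners arriving at the closed edge `e` are darts of the
  exploration of `ω` (`p = orb i₁`, partner `= orb i₂`, `i₁ < i₂`), then
  `arrivalSum φ β N + √2 · arrivalSum φ β' (N - (i₂ - i₁)) = 0` for the toggled configuration `β'`
  and every `φ` satisfying the case-2 table identity (`table_case2`, `table_case2_out`). Proof:
  the arrivals are exactly `{i₁, i₂}` resp. `{i₁}` (`cornerOrbit_toggle_case2`), equal prefixes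
  give equal turn counts, and the Umlaufsatz applied to the excised stretch — a cycle of the
  toggled rule of minimal period `i₂ - i₁` — gives `E(2C_{i₂}) = E(2C_{i₁}) · E(-4)`.
* **`arrivalSum_case1`**: if `p = orb i₁` arrives but its partner never does, then
  `√2 · arrivalSum φ β N + arrivalSum φ β' (N + Q) = 0` (`Q` = period of the partner's loop `L`),
  for every `φ` satisfying the case-1 identity (`table_case1`, `table_case1_out`): the arrivals
  are `{i₁}` resp. `{i₁, i₁ + Q}` (`cornerOrbit_toggle_case1`), and the Umlaufsatz for `L` gives
  the phase `E(4)` of the second arrival.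
* Reachability transfer between the wired subtype graph of `rcWeight` and the completed
  configuration (`reachable_wired_of_reachable_bc`, `reachable_bc_of_reachable_wired`, the latter
  under (H1): the discrete arc `A` is connected through `Ω_δ`), and the left chain
  `cornerOrbit_fst_reachable` / `reachable_of_both_arrive` (case 2 ⇒ the endpoints of `e` are
  joined by open edges, so the FK weight ratio is `√2`, `rcWeight_insert_critical`).

Remaining for node 1 (next instalment): case 0 (trivial), the per-`ω` classification with
period data and exit indices, the summation over pairs (`sum_powerset_pair`), and the projection
step (`FermionicObservableSums`).
-/

noncomputable section

namespace Literature.Probability.LatticeModels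

open SimpleGraph

namespace DiscreteDobrushin

variable {D : DiscreteDobrushin}

/-- **Arc-`A` walks are open**: a walk in the graph induced by `Ω_δ` on the discrete arc `A` maps
to a walk of open edges of any completed configuration (the completion opens every edge of `Ω_δ`
with both endpoints on `A`). [cite: Smirnov2010, §2.1 (Dobrushin boundary conditions: the arc is wired)] -/
theorem reachable_bc_of_arcWalk (ω : Percolation.BondConfig (Site 2)) {a b : D.zdArcA}
    (p : ((discreteDomainGraph D.Ω D.δ).induce D.zdArcA).Walk a b) :
    (Percolation.openGraph (D.bcBondConfig ω)).Reachable a.val b.val := by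
  induction p with
  | nil => exact Reachable.refl _
  | @cons a' b' c' hab' p' ih' =>
    refine Reachable.trans (Adj.reachable ?_) ih'
    rw [Percolation.openGraph_adj, mem_bcBondConfig_iff]
    have hadj : (discreteDomainGraph D.Ω D.δ).Adj a'.val b'.val := hab'
    refine ⟨⟨hadj, Or.inl ?_⟩, hadj.ne⟩
    intro x hx
    rcases Sym2.mem_iff.1 hx with rfl | rfl
    · exact a'.2
    · exact b'.2

/-- An edge of the completed configuration joins sites of `Ω_δ`. [cite: Smirnov2001, §2] -/
theorem mem_meshDomain_of_bc_adj {ω : Percolation.BondConfig (Site 2)} {x y : Site 2}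
    (h : (Percolation.openGraph (D.bcBondConfig ω)).Adj x y) : x ∈ meshDomain D.Ω D.δ ∧ y ∈ meshDomain D.Ω D.δ := by
  rw [Percolation.openGraph_adj] at h
  have he := D.bcBondConfig_subset ω h.1
  exact ⟨mem_meshDomain_of_mem_edge he (Sym2.mem_mk_left _ _), mem_meshDomain_of_mem_edge he (Sym2.mem_mk_right _ _)⟩

/-- **From the completed configuration to the wired subtype graph.** A walk of open edges of
`D.bcBondConfig (ι ω)` between two sites of `Ω_δ` lifts to a walk in the interface graph's
vertex type using the edges of `ω` and the wiring of the arc `A` (arc-`A` edges become wired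
adjacencies). [cite: Smirnov2010, §2.1 (Dobrushin boundary conditions)] -/
theorem reachable_wired_of_reachable_bc {ω : Finset (Sym2 (meshDomain D.Ω D.δ))}
    {x y : Site 2} (hx : x ∈ meshDomain D.Ω D.δ) (hy : y ∈ meshDomain D.Ω D.δ)
    (h : (Percolation.openGraph (D.bcBondConfig (liftConfig D.Ω D.δ ω))).Reachable x y) :
    (Percolation.openGraph (↑ω : Percolation.BondConfig (meshDomain D.Ω D.δ)) ⊔ wired (Subtype.val ⁻¹' D.zdArcA)).Reachable
      ⟨x, hx⟩ ⟨y, hy⟩ := by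
  obtain ⟨w⟩ := h
  induction w with
  | nil => exact Reachable.refl _
  | @cons a b c hab w ih =>
    have hb : b ∈ meshDomain D.Ω D.δ := (mem_meshDomain_of_bc_adj hab).2
    refine Reachable.trans (Adj.reachable ?_) (ih hb hy)
    rw [Percolation.openGraph_adj, mem_bcBondConfig_iff] at hab
    obtain ⟨⟨-, hA | ⟨hω, -⟩⟩, hne⟩ := hab
    · -- an arc-`A` edge: wired
      refine Or.inr ?_
      rw [wired_adj]
      exact ⟨fun h => hne (congrArg Subtype.val h), hA _ (Sym2.mem_mk_left _ _), hA _ (Sym2.mem_mk_right _ _)⟩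
    · -- an edge of `ω`
      refine Or.inl ?_
      rw [Percolation.openGraph_adj]
      refine ⟨?_, fun h => hne (congrArg Subtype.val h)⟩
      rw [mem_liftConfig_iff] at hω
      obtain ⟨e', he', hee'⟩ := hω
      have : e' = s(⟨a, hx⟩, ⟨b, hb⟩) := by
        apply sym2_map_val_injective
        rw [hee', Sym2.map_mk]
      rw [← this]; exact he'

/-- **From the wired subtype graph to the completed configuration, under (H1).** If the discrete
arc `A` is connected through the edges of `Ω_δ` (hypothesis (H1) of the corrected node-1 fact),
wired adjacencies are realised by walks of arc-`A` edges, which the completion opens; edges of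
`ω ⊆ E(interface graph)` lift to open edges. [cite: Smirnov2010, §2.1 (Dobrushin boundary conditions)] -/
theorem reachable_bc_of_reachable_wired (hA : ((discreteDomainGraph D.Ω D.δ).induce D.zdArcA).Preconnected)
    {ω : Finset (Sym2 (meshDomain D.Ω D.δ))} (hωE : ∀ e ∈ ω, Sym2.map Subtype.val e ∈ (discreteDomainGraph D.Ω D.δ).edgeSet ∧
      ∀ x ∈ Sym2.map Subtype.val e, x ∉ D.zdArcB)
    {u v : meshDomain D.Ω D.δ}
    (h : (Percolation.openGraph (↑ω : Percolation.BondConfig (meshDomain D.Ω D.δ)) ⊔ wired (Subtype.val ⁻¹' D.zdArcA)).Reachable u v) :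
    (Percolation.openGraph (D.bcBondConfig (liftConfig D.Ω D.δ ω))).Reachable u.val v.val := by
  obtain ⟨w⟩ := h
  induction w with
  | nil => exact Reachable.refl _
  | @cons a b c hab w ih =>
    refine Reachable.trans ?_ ih
    rcases hab with hab | hab
    · -- an edge of `ω`, open in the completion
      rw [Percolation.openGraph_adj] at hab
      obtain ⟨hω, hne⟩ := hab
      refine Adj.reachable ?_
      rw [Percolation.openGraph_adj, mem_bcBondConfig_iff]
      have hmem : s(a.val, b.val) ∈ liftConfig D.Ω D.δ ω := mem_liftConfig_iff.2 ⟨_, hω, by rw [Sym2.map_mk]⟩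
      obtain ⟨he, hB⟩ := hωE _ hω
      rw [Sym2.map_mk] at he hB
      exact ⟨⟨he, Or.inr ⟨hmem, hB⟩⟩, fun h => hne (Subtype.ext h)⟩
    · -- a wired jump between two arc-`A` sites: realise it along the arc
      rw [wired_adj] at hab
      obtain ⟨-, haA, hbA⟩ := hab
      obtain ⟨p⟩ := hA ⟨a.val, haA⟩ ⟨b.val, hbA⟩
      exact reachable_bc_of_arcWalk _ p

end DiscreteDobrushin


/-! ### Left vertices along an orbit are joined by open edges -/

/-- **The left chain of an orbit**: the vertices of the corners `orb i`, `orb j` (`i ≤ j`) of any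
orbit of the turning rule are joined by a walk of open edges (each step either keeps the vertex
or follows an open edge to its other endpoint). (Smirnov 2001, §2: open edges stay on the left.)
[cite: Smirnov2001, §2] -/
theorem cornerOrbit_fst_reachable (β : Percolation.BondConfig (Site 2)) (c : Site 2 × Fin 4) {i j : ℕ} (hij : i ≤ j) :
    (Percolation.openGraph β).Reachable (cornerOrbit β c i).1 (cornerOrbit β c j).1 := by
  induction j, hij using Nat.le_induction with
  | base => exact Reachable.refl _
  | succ j _ ih =>
    refine ih.trans ?_
    change (Percolation.openGraph β).Reachable (cornerOrbit β c j).1 (nextCorner β (cornerOrbit β c j)).1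
    by_cases h : cTgt (cornerOrbit β c j) ∈ β
    · rw [nextCorner_of_mem h]
      refine Adj.reachable ?_
      rw [Percolation.openGraph_adj]
      refine ⟨h, fun h' => cornerUnit_ne_zero ((cornerOrbit β c j).2 + 1) ?_⟩
      have h'' : (cornerOrbit β c j).1 = (cornerOrbit β c j).1 + cornerUnit ((cornerOrbit β c j).2 + 1) := h'
      simpa using h''.symm
    · rw [nextCorner_of_not_mem h]

/-- **Case 2 ⇒ the endpoints of `e` are joined**: if both corners arriving at `e = cTgt p` are darts
of the same orbit, `p = orb i₁` and `cornerPartner p = orb i₂`, then the endpoints `p.1` and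
`p.1 + u_{k+1}` of `e` are joined by open edges (whatever the order of `i₁`, `i₂`).
[cite: Smirnov2010, proof of Lemma 4.5] -/
theorem reachable_of_both_arrive (β : Percolation.BondConfig (Site 2)) (c : Site 2 × Fin 4) {p : Site 2 × Fin 4}
    {i₁ i₂ : ℕ} (h₁ : cornerOrbit β c i₁ = p) (h₂ : cornerOrbit β c i₂ = cornerPartner p) :
    (Percolation.openGraph β).Reachable p.1 (p.1 + cornerUnit (p.2 + 1)) := by
  have hy : (cornerPartner p).1 = p.1 + cornerUnit (p.2 + 1) := rfl
  rcases le_total i₁ i₂ with h | h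
  · have := cornerOrbit_fst_reachable β c h
    rwa [h₁, h₂, hy] at this
  · have := cornerOrbit_fst_reachable β c h
    rw [h₁, h₂, hy] at this
    exact this.symm


/-! ### The per-pair identities -/

section Pair

variable {D : DiscreteDobrushin} {ω ω' : Percolation.BondConfig (Site 2)} {c₀ p : Site 2 × Fin 4}

local notation "β" => D.bcBondConfig ω
local notation "β'" => D.bcBondConfig ω'
local notation "orb" => cornerOrbit (D.bcBondConfig ω) c₀
local notation "orb'" => cornerOrbit (D.bcBondConfig ω') c₀

open scoped Classical in
/-- The *arrival sum* at the edge `e = cTgt p` of the cut orbit of length `N₀`, with summand factor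
`φ`: `∑_{j<N₀, orb j ∈ {p, partner p}} eighthPhase (2 C_j) · φ (s_j)`. For `φ s = 1 - κ E(s)` this is
"arrivals minus `κ` times passages" (`passageSum_cTgt`), for `φ s = E(2s) - κ E(s)` "departures minus
`κ` times passages". [cite: Smirnov2010, proof of Lemma 4.5] -/
def arrivalSum (φ : ℤ → ℂ) (β₀ : Percolation.BondConfig (Site 2)) (c₀ p : Site 2 × Fin 4) (N₀ : ℕ) : ℂ :=
  ∑ j ∈ (Finset.range N₀).filter (fun j => cornerOrbit β₀ c₀ j = p ∨ cornerOrbit β₀ c₀ j = cornerPartner p),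
    eighthPhase (2 * turnCount β₀ c₀ j) * φ (turnSign β₀ (cornerOrbit β₀ c₀ j))

/-- `eighthPhase (x + 4 + 8) = eighthPhase (x + 4 - 8)`: only the residue mod `16` matters. [cite: Smirnov2010, §4] -/
theorem eighthPhase_shift_pm8 (x : ℤ) : eighthPhase (x + 4 + 8) = eighthPhase (x - 4) ∧ eighthPhase (x + 4 - 8) = eighthPhase (x - 4) := by
  constructor
  · rw [show x + 4 + 8 = (x - 4) + 16 by ring, eighthPhase_add_sixteen]
  · congr 1; ring

/-- **The pair identity, case 2** (both corners arriving at the closed edge `e = cTgt p` are darts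
of the exploration of `ω`, `p = orb i₁` before its partner `orb i₂`): the arrival sum of `ω`
plus `√2` times that of `ω ∪ e` (whose exploration has the stretch `i₁+1 … i₂` excised,
`cornerOrbit_toggle_case2`) vanishes, for every summand factor `φ` satisfying the case-2 table
identity. Inputs: the two arrivals of `ω` cross (`s = +1`), the single arrival of `ω ∪ e` follows
(`s = -1`) with the same prefix hence the same turn count, and the second arrival's phase is
`E(-4)` times the first by the Umlaufsatz `medialCycle_turning` applied to the excised loop (a
cycle of the toggled rule of minimal period `i₂ - i₁`). [cite: Smirnov2010, proof of Lemma 4.5] -/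
theorem arrivalSum_case2 (hD : D.IsZdAdmissible) (hc₀ : D.IsStartCorner c₀)
    (hagree : ∀ e, e ≠ cTgt p → (e ∈ β' ↔ e ∈ β)) (hdiff : ¬ (cTgt p ∈ β' ↔ cTgt p ∈ β)) (he : cTgt p ∉ β)
    (hT2 : medialCycle_turning) {N i₁ i₂ : ℕ}
    (hlt : ∀ k < N, D.IsInnerFace (cFace (orb k))) (hi₁ : orb i₁ = p) (hi₂ : orb i₂ = cornerPartner p)
    (h12 : i₁ < i₂) (hi₂N : i₂ < N) (φ : ℤ → ℂ)
    (hφ2 : ∀ a : ℂ, a * φ 1 + a * eighthPhase (-4) * φ 1 + (Real.sqrt 2 : ℂ) * (a * φ (-1)) = 0) :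
    arrivalSum φ β c₀ p N + (Real.sqrt 2 : ℂ) * arrivalSum φ β' c₀ p (N - (i₂ - i₁)) = 0 := by
  classical
  have he' : cTgt p ∈ β' := by
    by_contra h; exact hdiff ⟨fun h' => absurd h' h, fun h' => absurd h' he⟩
  have hinj : ∀ a b, a < N → b < N → orb a = orb b → a = b := by
    intro a b ha hb h
    by_contra hne
    rcases Nat.lt_or_gt_of_ne hne with hab | hab
    · exact cornerOrbit_ne hD hc₀ hab (fun k hk => hlt k (by omega)) h
    · exact cornerOrbit_ne hD hc₀ hab (fun k hk => hlt k (by omega)) h.symm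
  obtain ⟨hpre, htail⟩ := cornerOrbit_toggle_case2 hD hc₀ hagree hdiff hlt hi₁ hi₂ h12 hi₂N
  -- targets of darts strictly between or outside `{i₁, i₂}` are not `e`
  have htgt : ∀ j < N, j ≠ i₁ → j ≠ i₂ → cTgt (orb j) ≠ cTgt p := by
    intro j hj h1 h2 h
    rcases cTgt_eq_cTgt_iff.1 h with h | h
    · exact h1 (hinj j i₁ hj (by omega) (h.trans hi₁.symm))
    · exact h2 (hinj j i₂ hj hi₂N (h.trans hi₂.symm))
  -- the arrivals of `ω`: exactly `i₁` and `i₂`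
  have hfilt : (Finset.range N).filter (fun j => orb j = p ∨ orb j = cornerPartner p) = {i₁, i₂} := by
    ext j
    simp only [Finset.mem_filter, Finset.mem_range, Finset.mem_insert, Finset.mem_singleton]
    constructor
    · rintro ⟨hj, h | h⟩
      · exact Or.inl (hinj j i₁ hj (by omega) (h.trans hi₁.symm))
      · exact Or.inr (hinj j i₂ hj hi₂N (h.trans hi₂.symm))
    · rintro (rfl | rfl)
      · exact ⟨by omega, Or.inl hi₁⟩
      · exact ⟨hi₂N, Or.inr hi₂⟩
  -- the arrivals of `ω ∪ e`: exactly `i₁`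
  have hfilt' : (Finset.range (N - (i₂ - i₁))).filter (fun j => orb' j = p ∨ orb' j = cornerPartner p) = {i₁} := by
    ext j
    simp only [Finset.mem_filter, Finset.mem_range, Finset.mem_singleton]
    constructor
    · rintro ⟨hj, h⟩
      by_cases hji : j ≤ i₁
      · rw [hpre j hji] at h
        rcases h with h | h
        · exact hinj j i₁ (by omega) (by omega) (h.trans hi₁.symm)
        · have := hinj j i₂ (by omega) hi₂N (h.trans hi₂.symm); omega
      · exfalso
        have ht := htail (j - i₁ - 1) (by omega)
        rw [show i₁ + 1 + (j - i₁ - 1) = j by omega] at ht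
        rw [ht] at h
        have hidx : i₂ + 1 + (j - i₁ - 1) < N := by omega
        rcases h with h | h
        · have := hinj _ i₁ hidx (by omega) (h.trans hi₁.symm); omega
        · have := hinj _ i₂ hidx hi₂N (h.trans hi₂.symm); omega
    · rintro rfl
      exact ⟨by omega, Or.inl (by rw [hpre j le_rfl, hi₁])⟩
  -- turn counts: same prefix
  have hC : turnCount β' c₀ i₁ = turnCount β c₀ i₁ :=
    turnCount_congr_prefix hpre fun j hj => hagree _ (htgt j (by omega) (by omega) (by omega))
  -- the excised loop is a cycle of the toggled rule of minimal period `i₂ - i₁` from `orb (i₁+1)`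
  have hcyc : ∀ m, m + 1 ≤ i₂ - i₁ → cornerOrbit β' (orb (i₁ + 1)) m = orb (i₁ + 1 + m) := by
    intro m hm
    induction m with
    | zero => rfl
    | succ m ih =>
      change nextCorner β' (cornerOrbit β' (orb (i₁ + 1)) m) = _
      rw [ih (by omega), show i₁ + 1 + (m + 1) = (i₁ + 1 + m) + 1 by omega, cornerOrbit_succ]
      refine nextCorner_toggle_of_ne hagree hdiff (fun h => ?_) (fun h => ?_)
      · have := hinj _ i₁ (by omega) (by omega) (h.trans hi₁.symm); omega
      · have := hinj _ i₂ (by omega) hi₂N (h.trans hi₂.symm); omega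
  set M := i₂ - i₁ with hM
  have hM0 : 0 < M := by omega
  have hclose : cornerOrbit β' (orb (i₁ + 1)) M = orb (i₁ + 1) := by
    rw [show M = (M - 1) + 1 by omega]
    change nextCorner β' (cornerOrbit β' (orb (i₁ + 1)) (M - 1)) = _
    rw [hcyc (M - 1) (by omega), show i₁ + 1 + (M - 1) = i₂ by omega, hi₂, nextCorner_toggle hagree hdiff,
      Equiv.swap_apply_right, ← hi₁, ← cornerOrbit_succ]
  have hmin : ∀ s, 0 < s → s < M → cornerOrbit β' (orb (i₁ + 1)) s ≠ orb (i₁ + 1) := by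
    intro s hs hsM h
    rw [hcyc s (by omega)] at h
    have := hinj _ _ (by omega) (by omega) h
    omega
  -- the Umlaufsatz for the excised loop
  have hU := hT2 β' (orb (i₁ + 1)) M hM0 hclose hmin
  have hsum : ∑ m ∈ Finset.range M, turnSign β' (cornerOrbit β' (orb (i₁ + 1)) m) =
      (∑ m ∈ Finset.range (M - 1), turnSign β (orb (i₁ + 1 + m))) + (-1) := by
    rw [show M = (M - 1) + 1 by omega, Finset.sum_range_succ, Nat.add_sub_cancel]
    congr 1
    · refine Finset.sum_congr rfl fun m hm => ?_
      rw [Finset.mem_range] at hm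
      rw [hcyc m (by omega)]
      exact turnSign_congr (hagree _ (htgt _ (by omega) (by omega) (by omega)))
    · rw [hcyc (M - 1) (by omega), show i₁ + 1 + (M - 1) = i₂ by omega, hi₂]
      exact turnSign_of_mem (by rwa [cTgt_partner])
  rw [hsum] at hU
  -- the turn count at the second arrival
  have hC₂ : turnCount β c₀ i₂ = turnCount β c₀ i₁ + 1 + ∑ m ∈ Finset.range (M - 1), turnSign β (orb (i₁ + 1 + m)) := by
    rw [show i₂ = i₁ + M by omega, turnCount_add, show M = (M - 1) + 1 by omega, Finset.sum_range_succ', add_zero, hi₁,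
      turnSign_of_not_mem he, Nat.add_sub_cancel]
    have : ∀ m, i₁ + (m + 1) = i₁ + 1 + m := fun m => by omega
    rw [Finset.sum_congr rfl (fun m _ => by rw [this m])]
    ring
  have hphase : eighthPhase (2 * turnCount β c₀ i₂) = eighthPhase (2 * turnCount β c₀ i₁) * eighthPhase (-4) := by
    rw [← eighthPhase_add, hC₂]
    rcases hU with hU | hU
    · have hS : ∑ m ∈ Finset.range (M - 1), turnSign β (orb (i₁ + 1 + m)) = 5 := by omega
      rw [hS, show 2 * (turnCount β c₀ i₁ + 1 + 5) = 2 * turnCount β c₀ i₁ + 4 + 8 by ring,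
        (eighthPhase_shift_pm8 _).1, sub_eq_add_neg]
    · have hS : ∑ m ∈ Finset.range (M - 1), turnSign β (orb (i₁ + 1 + m)) = -3 := by omega
      rw [hS, show 2 * (turnCount β c₀ i₁ + 1 + -3) = 2 * turnCount β c₀ i₁ + 4 - 8 by ring,
        (eighthPhase_shift_pm8 _).2, sub_eq_add_neg]
  -- assemble
  rw [arrivalSum, hfilt, Finset.sum_pair (by omega : i₁ ≠ i₂), arrivalSum, hfilt', Finset.sum_singleton, hi₁, hi₂,
    hpre i₁ le_rfl, hi₁, turnSign_of_not_mem he, turnSign_of_not_mem (show cTgt (cornerPartner p) ∉ β by rwa [cTgt_partner]),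
    turnSign_of_mem he', hC, hphase]
  linear_combination hφ2 (eighthPhase (2 * turnCount β c₀ i₁))

/-- `eighthPhase (x - 4 + 8) = eighthPhase (x + 4) = eighthPhase (x - 4 - 8)`. [cite: Smirnov2010, §4] -/
theorem eighthPhase_shift_pm8' (x : ℤ) : eighthPhase (x - 4 + 8) = eighthPhase (x + 4) ∧ eighthPhase (x - 4 - 8) = eighthPhase (x + 4) := by
  constructor
  · congr 1; ring
  · rw [show x + 4 = (x - 4 - 8) + 16 by ring, eighthPhase_add_sixteen]

/-- **The pair identity, case 1** (`p = orb i₁` arrives at the closed interior edge `e = cTgt p`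
but its partner never does): `√2` times the arrival sum of `ω` plus that of `ω ∪ e` (whose
exploration has the partner's loop `L` spliced in, `cornerOrbit_toggle_case1`, and arrives at `e`
twice, both times following) vanishes for every `φ` satisfying the case-1 table identity. The
second arrival's phase is `E(4)` times the first by `medialCycle_turning` applied to `L`.
[cite: Smirnov2010, proof of Lemma 4.5] -/
theorem arrivalSum_case1 (hD : D.IsZdAdmissible) (hc₀ : D.IsStartCorner c₀)
    (hagree : ∀ e, e ≠ cTgt p → (e ∈ β' ↔ e ∈ β)) (hdiff : ¬ (cTgt p ∈ β' ↔ cTgt p ∈ β)) (he : cTgt p ∉ β)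
    (hT2 : medialCycle_turning)
    (hx : ∀ j, D.IsInnerFace (faceAt p.1 j)) (hy : ∀ j, D.IsInnerFace (faceAt (p.1 + cornerUnit (p.2 + 1)) j))
    {N P Q i₁ : ℕ} (hN : ¬ D.IsInnerFace (cFace (orb N))) (hlt : ∀ k < N, D.IsInnerFace (cFace (orb k)))
    (hP0 : 0 < P) (hP : orb P = c₀) (hPmin : ∀ s, 0 < s → s < P → orb s ≠ c₀)
    (hQ0 : 0 < Q) (hQ : cornerOrbit β (cornerPartner p) Q = cornerPartner p)
    (hQmin : ∀ s, 0 < s → s < Q → cornerOrbit β (cornerPartner p) s ≠ cornerPartner p)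
    (hi₁ : orb i₁ = p) (hi₁N : i₁ < N) (h₂ : ∀ i < N, orb i ≠ cornerPartner p) (φ : ℤ → ℂ)
    (hφ1 : ∀ a : ℂ, (Real.sqrt 2 : ℂ) * (a * φ 1) + (a * φ (-1) + a * eighthPhase 4 * φ (-1)) = 0) :
    (Real.sqrt 2 : ℂ) * arrivalSum φ β c₀ p N + arrivalSum φ β' c₀ p (N + Q) = 0 := by
  classical
  set p₂ := cornerPartner p with hp₂
  have he' : cTgt p ∈ β' := by
    by_contra h; exact hdiff ⟨fun h' => absurd h' h, fun h' => absurd h' he⟩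
  have hinj : ∀ a b, a < N → b < N → orb a = orb b → a = b := by
    intro a b ha hb h
    by_contra hne
    rcases Nat.lt_or_gt_of_ne hne with hab | hab
    · exact cornerOrbit_ne hD hc₀ hab (fun k hk => hlt k (by omega)) h
    · exact cornerOrbit_ne hD hc₀ hab (fun k hk => hlt k (by omega)) h.symm
  -- the loop never meets the interface cycle
  have hdisj : ∀ m s, cornerOrbit β p₂ m ≠ orb s := by
    intro m s h
    obtain ⟨s', hs'⟩ := exists_eq_cornerOrbit_of_iterate hP0 hP m h
    have hin : D.IsInnerFace (cFace (orb s')) := hs' ▸ hy _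
    rw [isInnerFace_cornerOrbit_iff hD hc₀ hN hlt hP0 hP hPmin] at hin
    exact h₂ _ hin (by rw [cornerOrbit_mod_period hP]; exact hs'.symm)
  obtain ⟨hpre, hloop, htail, -, -⟩ := cornerOrbit_toggle_case1 hD hc₀ hagree hdiff hx hy hN hlt hP0 hP hPmin hQ0 hQ
    hQmin hi₁ hi₁N h₂
  -- the arrivals of `ω`: exactly `i₁`
  have hfilt : (Finset.range N).filter (fun j => orb j = p ∨ orb j = p₂) = {i₁} := by
    ext j
    simp only [Finset.mem_filter, Finset.mem_range, Finset.mem_singleton]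
    constructor
    · rintro ⟨hj, h | h⟩
      · exact hinj j i₁ hj hi₁N (h.trans hi₁.symm)
      · exact absurd h (h₂ j hj)
    · rintro rfl; exact ⟨hi₁N, Or.inl hi₁⟩
  -- the arrivals of `ω ∪ e`: `i₁` and `i₁ + Q`
  have hloopQ : orb' (i₁ + Q) = p₂ := by
    have := hloop (Q - 1) (by omega)
    rwa [show i₁ + 1 + (Q - 1) = i₁ + Q by omega, Nat.sub_add_cancel hQ0, hQ] at this
  have hfilt' : (Finset.range (N + Q)).filter (fun j => orb' j = p ∨ orb' j = p₂) = {i₁, i₁ + Q} := by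
    ext j
    simp only [Finset.mem_filter, Finset.mem_range, Finset.mem_insert, Finset.mem_singleton]
    constructor
    · rintro ⟨hj, h⟩
      by_cases hj1 : j ≤ i₁
      · rw [hpre j hj1] at h
        rcases h with h | h
        · exact Or.inl (hinj j i₁ (by omega) hi₁N (h.trans hi₁.symm))
        · exact absurd h (h₂ j (by omega))
      · by_cases hj2 : j ≤ i₁ + Q
        · right
          have hl := hloop (j - i₁ - 1) (by omega)
          rw [show i₁ + 1 + (j - i₁ - 1) = j by omega] at hl
          rw [hl] at h
          rcases h with h | h
          · exact absurd (h.trans hi₁.symm) (hdisj _ _)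
          · by_contra hne
            exact hQmin (j - i₁ - 1 + 1) (Nat.succ_pos _) (by omega) h
        · exfalso
          have ht := htail (j - i₁ - Q - 1) (by omega)
          rw [show i₁ + Q + 1 + (j - i₁ - Q - 1) = j by omega] at ht
          rw [ht] at h
          have hidx : i₁ + 1 + (j - i₁ - Q - 1) < N := by omega
          rcases h with h | h
          · have := hinj _ i₁ hidx hi₁N (h.trans hi₁.symm); omega
          · exact h₂ _ hidx h
    · rintro (rfl | rfl)
      · exact ⟨by omega, Or.inl (by rw [hpre j le_rfl, hi₁])⟩
      · exact ⟨by omega, Or.inr hloopQ⟩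
  -- targets before `i₁` are not `e`; same prefix turn count
  have htgt : ∀ j < N, j ≠ i₁ → cTgt (orb j) ≠ cTgt p := by
    intro j hj h1 h
    rcases cTgt_eq_cTgt_iff.1 h with h | h
    · exact h1 (hinj j i₁ hj hi₁N (h.trans hi₁.symm))
    · exact h₂ j hj h
  have hC : turnCount β' c₀ i₁ = turnCount β c₀ i₁ :=
    turnCount_congr_prefix hpre fun j hj => hagree _ (htgt j (by omega) (by omega))
  -- the loop corners' targets are not `e` (except at `p₂` itself)
  have hLtgt : ∀ m, 0 < m → m < Q → cTgt (cornerOrbit β p₂ m) ≠ cTgt p := by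
    intro m hm hmQ h
    rcases cTgt_eq_cTgt_iff.1 h with h | h
    · exact hdisj m i₁ (h.trans hi₁.symm)
    · exact hQmin m hm hmQ h
  -- Umlaufsatz for `L` (in `β`): the turns after the first sum to `±4 - 1`
  have hU := hT2 β p₂ Q hQ0 hQ hQmin
  rw [show Q = (Q - 1) + 1 by omega, Finset.sum_range_succ'] at hU
  have hs0 : turnSign β (cornerOrbit β p₂ 0) = 1 := turnSign_of_not_mem (by
    change cTgt p₂ ∉ β; rwa [hp₂, cTgt_partner])
  rw [hs0] at hU
  -- the turn count at the second arrival of `ω ∪ e`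
  have hC₂ : turnCount β' c₀ (i₁ + Q) = turnCount β c₀ i₁ - 1 +
      ∑ m ∈ Finset.range (Q - 1), turnSign β (cornerOrbit β p₂ (m + 1)) := by
    rw [turnCount_add, show Q = (Q - 1) + 1 by omega, Finset.sum_range_succ', Nat.sub_add_cancel hQ0, add_zero, hpre i₁ le_rfl,
      hi₁, turnSign_of_mem he', hC]
    have hterm : ∀ m ∈ Finset.range (Q - 1), turnSign β' (orb' (i₁ + (m + 1))) = turnSign β (cornerOrbit β p₂ (m + 1)) := by
      intro m hm
      rw [Finset.mem_range] at hm
      rw [show i₁ + (m + 1) = i₁ + 1 + m by omega, hloop m (by omega)]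
      exact turnSign_congr (hagree _ (hLtgt (m + 1) (Nat.succ_pos _) (by omega)))
    rw [Finset.sum_congr rfl hterm]
    ring
  have hphase : eighthPhase (2 * turnCount β' c₀ (i₁ + Q)) = eighthPhase (2 * turnCount β c₀ i₁) * eighthPhase 4 := by
    rw [← eighthPhase_add, hC₂]
    rcases hU with hU | hU
    · have hS : ∑ m ∈ Finset.range (Q - 1), turnSign β (cornerOrbit β p₂ (m + 1)) = 3 := by omega
      rw [hS, show 2 * (turnCount β c₀ i₁ - 1 + 3) = 2 * turnCount β c₀ i₁ - 4 + 8 by ring, (eighthPhase_shift_pm8' _).1]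
    · have hS : ∑ m ∈ Finset.range (Q - 1), turnSign β (cornerOrbit β p₂ (m + 1)) = -5 := by omega
      rw [hS, show 2 * (turnCount β c₀ i₁ - 1 + -5) = 2 * turnCount β c₀ i₁ - 4 - 8 by ring, (eighthPhase_shift_pm8' _).2]
  -- assemble
  rw [arrivalSum, hfilt, Finset.sum_singleton, arrivalSum, hfilt', Finset.sum_pair (by omega : i₁ ≠ i₁ + Q), hi₁,
    hpre i₁ le_rfl, hi₁, hloopQ, turnSign_of_not_mem he, turnSign_of_mem he',
    turnSign_of_mem (show cTgt p₂ ∈ β' by rwa [hp₂, cTgt_partner]), hC, hphase]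
  linear_combination hφ1 (eighthPhase (2 * turnCount β c₀ i₁))

end Pair

end Literature.Probability.LatticeModels
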